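import Summits.ValiantsHypothesis.ValiantsHypothesis.Theses.NewtonUnitEquations
-- import Summits.ValiantsHypothesis.ValiantsHypothesis.Theorems.DissociatedFixedK.Negative.CubeLemma
-- import Summits.ValiantsHypothesis.ValiantsHypothesis.Theorems.DissociatedFixedK.Negative.LoadBearing
--   (both LANDED — p73482 / LoadBearing — but not yet in the farm snapshot at skeleton time: lean check answers
--    `remote:stale:unbuilt:…Negative.CubeLemma|LoadBearing`; re-enable when built.  CubeLemma is not used by this
--    line (checked against only); LoadBearing supplies `Negative.mem_extremePoints_convexHull_of_strict_sep` for
--    STUB 2 and the `_false_without_card/_supp` theorems this skeleton honours — see the header.)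
import Literature.Computability.AlgebraicComplexity.NewtonPolygonTau

/-!
# Skeleton line `slice-contraction-descent` for crux `DissociatedFixedK` (stmt-ValiantsHypothesis-5907)

Route `NewtonUnitEquations`, crux r4 `DissociatedFixedK` =
`∀ k, ∃ C, ∀ m t (A : Fin m → Finset ℕ²) (f : Fin k → Fin m → ℂ[X,Y]), (∀ j, #A j ≤ t) →
(∀ i j, supp f i j ⊆ A j) → (the sum map is injective on Π_j A j) →
#vert Newt(Σ_i Π_j f i j) ≤ (m t + 2)^C`.

## The line (crux idea card `Ideas/slice-contraction-descent.md`, ideator 1; triage r1: pass ×3)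

LEVER = Strassen's substitution method run FORWARD as a counting recursion on the number of product
slots `k`.  Work with WEIGHTED sums `F = Σ_i C(λ_i)·Π_j f_ij` on a dissociated frame `A` (the crux is
`λ ≡ 1`).  Under dissociation the coefficient of `X^{Σ_j a_j}` in `F` is the rank-`≤ k` tensor
`T(a) = Σ_i λ_i Π_j coeff_{a_j} f_ij` (blueprint step 1), and a vertex `p` of `Newt(F)` exposed by a
direction `w` (chosen injective on every `A_j`, `exists_strict_direction` of SketchIdeator3) is
`p = ι(Σ_j b_j)` for the STRICT `w`-TOP SURVIVOR `b`: `T b ≠ 0` and `T a = 0` for every other frame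
word `a` of `w`-height `≥` that of `b` (`stub_exposedWord`; converse `stub_wordVertex`).  DICHOTOMY:
* Case 2 — some product `i₀` has a letter `y ∈ A_j` with `coeff_y f_{i₀ j} ≠ 0` STRICTLY `w`-above
  `b_j`.  Contract coordinate `j` against the functional `c_{i₀ j}(b_j)·coeff_y − c_{i₀ j}(y)·coeff_{b_j}`:
  this kills product `i₀` (`contractWeights_self`), and `topSurvivor_contract` (PROVED, ideator 1,
  carried verbatim below) says the punctured word `b ∘ j.succAbove` is the strict `w`-top survivor of
  the contracted tensor — which is the coefficient tensor of the `k`-slot, `m`-coordinate instance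
  `slice λ f i₀ j y b_j` on the punctured (still dissociated) frame.  Hence
  `p = ι(b_j) + (a vertex of Newt(slice λ f i₀ j y b_j))`.
* Case 1 — otherwise `b` is the coordinatewise `w`-argmax word of the LIVE frame
  `(⋃_i supp_j f_ij)_j` (`topWords (liveFrame f)`), and such words are few as `w` turns:
  `≤ 4((m+1)t)² + 7` (`stub_topWordsCount`; = Disproof v3 §E3/§E4 `ncard_range_topTuple_le`, CHECKED).
So `V(F) ≤ #topWords(liveFrame f) + Σ_{i₀, j, y ∈ A_j, y' ∈ A_j} V(slice λ f i₀ j y y')`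
(`stub_descent`), the slices have `k` slots on `m` coordinates, and induction on `k` gives
`V ≤ (mt+2)^{e(k)}` with `e(0) = 0`, `e(k+1) = e(k) + k + 9` (`wbound_succ`, arithmetic `step_arith`) —
exponential in `k`, as it must be (`Disproof.lean` §C `not_dissociatedFixedKUniformC`: `C(k) → ∞`).
NO cube lemma, NO alive-pattern stratification, NO thickness radius; genericity enters once (the
injective direction `w`).

## Stubs (4) and composition
* `stub_exposedWord` (M): vertex ⇒ strict top-survivor word for a direction injective on every `A_j`.
* `stub_wordVertex` (M⁻): strict top-survivor word ⇒ vertex (any direction).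
* `stub_descent` (M/L, LOAD-BEARING): the two dictionary stubs ⇒ the descent inequality.
* `stub_topWordsCount` (M⁻ given Disproof v3 §E3/§E4): `#topWords B ≤ 4(nt)² + 7` for any planar family
  `B : Fin n → Finset ℕ²` with `#B j ≤ t` (argmax words over injective directions ⊆ range of `lexTop` tuples).
`DissociatedFixedK_of` composes them into the crux BY NAME (kernel-checked, no `sorry`): weighted
bound `WBound k e` by induction on `k` (`wbound_zero`, `wbound_succ` — uses `stub_descent`,
`stub_topWordsCount`, the punctured-frame dissociation `dissoc_punctured`, the constant case
`newtonVertexCount_C_le` and `step_arith`), then `λ ≡ 1`.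

## Disproof used (Cruxes/DissociatedFixedK/Disproof.lean v3; landed Negative/CubeLemma.lean, Negative/LoadBearing.lean)
* §E PROVER KIT (v3, CHECKED): §E0/§E1 are the engines of STUBS 1–2, §E3/§E4
  (`ncard_range_topTuple_le`) is the engine of STUB 4 — the stub bounds are chosen to be exactly what
  the kit delivers (`4(nt)²+7` with `#P ≤ nt`).
* `dissociatedFixedK_false_without_supp` honoured: `supp f i j ⊆ A j` is a hypothesis of
  `stub_exposedWord`, `stub_wordVertex`, `stub_descent` (frame words carry the support).
* `dissociatedFixedK_false_without_card` honoured: `#A j ≤ t` enters in `wbound_succ` (Case-1 count via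
  `#liveFrame f j ≤ #A j ≤ t`, and the `≤ t²` letters `y, y' ∈ A j` per `(i₀, j)`).
* Dissociation is used in `stub_exposedWord`/`stub_wordVertex` (coefficient = tensor value) and is
  inherited by the punctured frame (`dissoc_punctured`, proved).
* §C (`¬ UniformC`): the bound here is `(mt+2)^{O(k²)}`, `C(k) → ∞` — consistent.
* §A/§A' (cube lemma, thickness `k-1` attained): not used and not contradicted (no thickness claim).
No stub is an instance of a refuted statement (`ledger negatives`: 4 items, none on Newton polygons).
-/

set_option linter.dupNamespace false
set_option linter.unusedVariables false

namespace Summit.ValiantsHypothesis.ValiantsHypothesis.Cruxes.DissociatedFixedK.SliceContractionDescent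

open scoped BigOperators
open Finset MvPolynomial Literature.Computability.AlgebraicComplexity

noncomputable section

/-! ## Vocabulary (all over existing declarations) -/

/-- The embedding `ℕ² → ℝ²` of exponent vectors — literally the crux's `fun e i => ((e i : ℕ) : ℝ)`. -/
def emb (e : Fin 2 →₀ ℕ) : Fin 2 → ℝ := fun i => ((e i : ℕ) : ℝ)

/-- The vertex set of the Newton polygon of `p` (so that `newtonVertexCount p = (Vert p).ncard`, `rfl`). -/
def Vert (p : MvPolynomial (Fin 2) ℂ) : Set (Fin 2 → ℝ) :=
  Set.extremePoints ℝ (convexHull ℝ (emb '' (p.support : Set (Fin 2 →₀ ℕ))))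

theorem newtonVertexCount_eq_ncard_vert (p : MvPolynomial (Fin 2) ℂ) :
    newtonVertexCount p = (Vert p).ncard := rfl

/-- Height of an exponent vector in direction `w`: `⟨w, emb e⟩`. -/
def ht (w : Fin 2 → ℝ) (e : Fin 2 →₀ ℕ) : ℝ := ∑ i, w i * ((e i : ℕ) : ℝ)

/-- Dissociation of a frame `A`: the sum map is injective on the frame words `Π_j A j`
(verbatim the crux's third hypothesis). -/
def Dissoc {m : ℕ} (A : Fin m → Finset (Fin 2 →₀ ℕ)) : Prop :=
  ∀ a b : Fin m → (Fin 2 →₀ ℕ), (∀ j, a j ∈ A j) → (∀ j, b j ∈ A j) → ∑ j, a j = ∑ j, b j → a = b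

/-- Coefficient slices of a family: `cT f i j y = coeff_y (f i j)`. -/
def cT {k m : ℕ} (f : Fin k → Fin m → MvPolynomial (Fin 2) ℂ) : Fin k → Fin m → (Fin 2 →₀ ℕ) → ℂ :=
  fun i j y => coeff y (f i j)

/-- The LIVE frame of a family: letters of coordinate `j` used by some product. -/
def liveFrame {k n : ℕ} (f : Fin k → Fin n → MvPolynomial (Fin 2) ℂ) (j : Fin n) :
    Finset (Fin 2 →₀ ℕ) :=
  Finset.univ.biUnion fun i => (f i j).support

theorem liveFrame_subset {k n : ℕ} (A : Fin n → Finset (Fin 2 →₀ ℕ))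
    (f : Fin k → Fin n → MvPolynomial (Fin 2) ℂ) (hf : ∀ i j, (f i j).support ⊆ A j) (j : Fin n) :
    liveFrame f j ⊆ A j :=
  Finset.biUnion_subset.2 fun i _ => hf i j

/-- TOP WORDS of a planar family `B`: the coordinatewise `w`-argmax words, over all directions `w`
whose height is injective on every `B j` (then the argmax word is unique). -/
def topWords {n : ℕ} (B : Fin n → Finset (Fin 2 →₀ ℕ)) : Set (Fin n → (Fin 2 →₀ ℕ)) :=
  {b | ∃ w : Fin 2 → ℝ, (∀ j, Set.InjOn (ht w) (B j : Set (Fin 2 →₀ ℕ))) ∧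
    ∀ j, b j ∈ B j ∧ ∀ y ∈ B j, ht w y ≤ ht w (b j)}

/-! ## The contraction engine (ideator 1, `Sketch-ideator1.lean`; PROVED, carried verbatim) -/

section Tensor

variable {X : Type*}

/-- Coefficient tensor of the weighted sum of products `Σ_i λ_i Π_j f_ij` on a frame:
`T(a) = Σ_i λ_i Π_j c_ij(a_j)` (with `c_ij(y) = coeff y (f i j)`). -/
def tensorOf {k m : ℕ} (lam : Fin k → ℂ) (c : Fin k → Fin m → X → ℂ) (a : Fin m → X) : ℂ :=
  ∑ i, lam i * ∏ j, c i j (a j)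

/-- Weights of the contraction killing product `i0` through coordinate `j` at the two letters
`y` (upper) and `y'` (lower): `λ'_i = λ_i · (c_ij(y) c_{i0 j}(y') - c_ij(y') c_{i0 j}(y))`. -/
def contractWeights {k m : ℕ} (lam : Fin k → ℂ) (c : Fin k → Fin (m + 1) → X → ℂ)
    (i0 : Fin k) (j : Fin (m + 1)) (y y' : X) : Fin k → ℂ :=
  fun i => lam i * (c i j y * c i0 j y' - c i j y' * c i0 j y)

/-- The killed product has weight `0`. -/
theorem contractWeights_self {k m : ℕ} (lam : Fin k → ℂ) (c : Fin k → Fin (m + 1) → X → ℂ)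
    (i0 : Fin k) (j : Fin (m + 1)) (y y' : X) : contractWeights lam c i0 j y y' i0 = 0 := by
  simp [contractWeights, mul_comm]

/-- The contracted tensor is the corresponding combination of the two `j`-slices. -/
theorem tensorOf_contract {k m : ℕ} (lam : Fin k → ℂ) (c : Fin k → Fin (m + 1) → X → ℂ)
    (i0 : Fin k) (j : Fin (m + 1)) (y y' : X) (a' : Fin m → X) :
    tensorOf (contractWeights lam c i0 j y y') (fun i l => c i (j.succAbove l)) a' =
      c i0 j y' * tensorOf lam c (Fin.insertNth (α := fun _ => X) j y a') -
        c i0 j y * tensorOf lam c (Fin.insertNth (α := fun _ => X) j y' a') := by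
  simp only [tensorOf, contractWeights]
  rw [Finset.mul_sum, Finset.mul_sum, ← Finset.sum_sub_distrib]
  refine Finset.sum_congr rfl fun i _ => ?_
  rw [Fin.prod_univ_succAbove (fun j' => c i j' (Fin.insertNth (α := fun _ => X) j y a' j')) j,
    Fin.prod_univ_succAbove (fun j' => c i j' (Fin.insertNth (α := fun _ => X) j y' a' j')) j]
  simp only [Fin.insertNth_apply_same, Fin.insertNth_apply_succAbove]
  ring

/-- **Top-survivor descent under slice contraction** (ideator 1's first lemma, PROVED; no genericity,
no aliveness pattern, no cube).  If `b` is a strict top survivor of `T = Σ_i λ_i ⊗_j c_ij` on the frame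
`Π_j A_j` for the heights `h_j`, and product `i0` has a letter `y ∈ A_j` with `c_{i0 j}(y) ≠ 0`
STRICTLY above `b_j`, then the punctured word `b ∘ j.succAbove` is a strict top survivor of the
contraction (which kills `i0`, `contractWeights_self`). -/
theorem topSurvivor_contract {k m : ℕ} (A : Fin (m + 1) → Finset X) (h : Fin (m + 1) → X → ℝ)
    (lam : Fin k → ℂ) (c : Fin k → Fin (m + 1) → X → ℂ) (b : Fin (m + 1) → X)
    (hb : ∀ j, b j ∈ A j)
    (htop : ∀ a : Fin (m + 1) → X, (∀ j, a j ∈ A j) → a ≠ b →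
      ∑ j, h j (b j) ≤ ∑ j, h j (a j) → tensorOf lam c a = 0)
    (hTb : tensorOf lam c b ≠ 0)
    (i0 : Fin k) (j : Fin (m + 1)) (y : X) (hy : y ∈ A j) (hyc : c i0 j y ≠ 0)
    (hyh : h j (b j) < h j y) :
    tensorOf (contractWeights lam c i0 j y (b j)) (fun i l => c i (j.succAbove l))
        (fun l => b (j.succAbove l)) ≠ 0 ∧
      ∀ a' : Fin m → X, (∀ l, a' l ∈ A (j.succAbove l)) → a' ≠ (fun l => b (j.succAbove l)) →
        ∑ l, h (j.succAbove l) (b (j.succAbove l)) ≤ ∑ l, h (j.succAbove l) (a' l) →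
        tensorOf (contractWeights lam c i0 j y (b j)) (fun i l => c i (j.succAbove l)) a' = 0 := by
  have hyne : y ≠ b j := by
    intro e
    rw [e] at hyh
    exact lt_irrefl _ hyh
  have mem_ins : ∀ (z : X) (a' : Fin m → X), z ∈ A j → (∀ l, a' l ∈ A (j.succAbove l)) →
      ∀ j', Fin.insertNth (α := fun _ => X) j z a' j' ∈ A j' := by
    intro z a' hz ha'
    refine (Fin.forall_iff_succAbove j).2 ⟨?_, fun l => ?_⟩
    · simpa using hz
    · simpa using ha' l
  have sum_ins : ∀ (z : X) (a' : Fin m → X),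
      ∑ j', h j' (Fin.insertNth (α := fun _ => X) j z a' j') =
        h j z + ∑ l, h (j.succAbove l) (a' l) := by
    intro z a'
    rw [Fin.sum_univ_succAbove _ j]
    simp
  have sum_b : ∑ j', h j' (b j') = h j (b j) + ∑ l, h (j.succAbove l) (b (j.succAbove l)) :=
    Fin.sum_univ_succAbove _ j
  have ins_y_ne : ∀ a' : Fin m → X, Fin.insertNth (α := fun _ => X) j y a' ≠ b := by
    intro a' e
    have := congrFun e j
    simp only [Fin.insertNth_apply_same] at this
    exact hyne this
  refine ⟨?_, ?_⟩
  · rw [tensorOf_contract]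
    have h1 : tensorOf lam c (Fin.insertNth (α := fun _ => X) j y fun l => b (j.succAbove l)) = 0 := by
      refine htop _ (mem_ins y _ hy fun l => hb _) (ins_y_ne _) ?_
      rw [sum_ins, sum_b]
      linarith
    have h2 : Fin.insertNth (α := fun _ => X) j (b j) (fun l => b (j.succAbove l)) = b :=
      Fin.insertNth_self_removeNth j b
    rw [h1, h2, mul_zero, zero_sub, neg_ne_zero]
    exact mul_ne_zero hyc hTb
  · intro a' ha' hne hle
    rw [tensorOf_contract]
    have e1 : tensorOf lam c (Fin.insertNth (α := fun _ => X) j y a') = 0 := by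
      refine htop _ (mem_ins y a' hy ha') (ins_y_ne _) ?_
      rw [sum_ins, sum_b]
      linarith
    have e2 : tensorOf lam c (Fin.insertNth (α := fun _ => X) j (b j) a') = 0 := by
      refine htop _ (mem_ins (b j) a' (hb j) ha') ?_ ?_
      · intro e
        apply hne
        funext l
        have := congrFun e (j.succAbove l)
        simpa using this
      · rw [sum_ins, sum_b]
        linarith
    rw [e1, e2, mul_zero, mul_zero, sub_zero]

end Tensor

/-- `b` is a STRICT `w`-TOP SURVIVOR of the coefficient tensor of `Σ_i C(λ_i) Π_j f_ij` on the frame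
`A`: a frame word with `T b ≠ 0` such that every OTHER frame word of `w`-height `≥` that of `b` is a
zero of `T`. (Exactly the hypothesis shape of `topSurvivor_contract` with `h j := ht w`, `c := cT f`.) -/
def IsTopSurvivor {k m : ℕ} (A : Fin m → Finset (Fin 2 →₀ ℕ)) (lam : Fin k → ℂ)
    (f : Fin k → Fin m → MvPolynomial (Fin 2) ℂ) (w : Fin 2 → ℝ) (b : Fin m → (Fin 2 →₀ ℕ)) : Prop :=
  (∀ j, b j ∈ A j) ∧ tensorOf lam (cT f) b ≠ 0 ∧
    ∀ a : Fin m → (Fin 2 →₀ ℕ), (∀ j, a j ∈ A j) → a ≠ b →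
      ∑ j, ht w (b j) ≤ ∑ j, ht w (a j) → tensorOf lam (cT f) a = 0

/-- The SLICE CONTRACTION of a `(k+1)`-slot family on `m+1` coordinates at `(i₀, j, y, y')`: the
`k`-slot, `m`-coordinate weighted family obtained by contracting coordinate `j` against
`c_{i₀ j}(y')·coeff_y − c_{i₀ j}(y)·coeff_{y'}` and dropping the killed slot `i₀`
(its weight is `0`, `contractWeights_self`).  Written literally in the shape of `WBound k`. -/
def slice {k m : ℕ} (lam : Fin (k + 1) → ℂ) (f : Fin (k + 1) → Fin (m + 1) → MvPolynomial (Fin 2) ℂ)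
    (i0 : Fin (k + 1)) (j : Fin (m + 1)) (y y' : Fin 2 →₀ ℕ) : MvPolynomial (Fin 2) ℂ :=
  ∑ i' : Fin k, C (contractWeights lam (cT f) i0 j y y' (i0.succAbove i')) *
    ∏ l : Fin m, f (i0.succAbove i') (j.succAbove l)

/-- The weighted form of the crux's matrix at `k` slots with exponent `e` (the induction statement). -/
def WBound (k e : ℕ) : Prop :=
  ∀ (m t : ℕ) (A : Fin m → Finset (Fin 2 →₀ ℕ)) (lam : Fin k → ℂ)
    (f : Fin k → Fin m → MvPolynomial (Fin 2) ℂ),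
    (∀ j, (A j).card ≤ t) → (∀ i j, (f i j).support ⊆ A j) → Dissoc A →
    newtonVertexCount (∑ i, C (lam i) * ∏ j, f i j) ≤ (m * t + 2) ^ e

/-! ## Named statements of the four stubs -/

/-- Statement of `stub_exposedWord` (blueprint steps 1–2, forward). -/
def ExposedWordStmt : Prop :=
  ∀ (k m : ℕ) (A : Fin m → Finset (Fin 2 →₀ ℕ)) (lam : Fin k → ℂ)
    (f : Fin k → Fin m → MvPolynomial (Fin 2) ℂ),
    (∀ i j, (f i j).support ⊆ A j) → Dissoc A →
    ∀ p ∈ Vert (∑ i, C (lam i) * ∏ j, f i j),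
      ∃ (w : Fin 2 → ℝ) (b : Fin m → (Fin 2 →₀ ℕ)),
        (∀ j, Set.InjOn (ht w) (A j : Set (Fin 2 →₀ ℕ))) ∧ IsTopSurvivor A lam f w b ∧
          p = emb (∑ j, b j)

/-- Statement of `stub_wordVertex` (blueprint steps 1–2, backward). -/
def WordVertexStmt : Prop :=
  ∀ (k m : ℕ) (A : Fin m → Finset (Fin 2 →₀ ℕ)) (lam : Fin k → ℂ)
    (f : Fin k → Fin m → MvPolynomial (Fin 2) ℂ),
    (∀ i j, (f i j).support ⊆ A j) → Dissoc A →
    ∀ (w : Fin 2 → ℝ) (b : Fin m → (Fin 2 →₀ ℕ)), IsTopSurvivor A lam f w b →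
      emb (∑ j, b j) ∈ Vert (∑ i, C (lam i) * ∏ j, f i j)

/-- Statement of the conclusion of `stub_descent` (the descent inequality). -/
def DescentCore : Prop :=
  ∀ (k m : ℕ) (A : Fin (m + 1) → Finset (Fin 2 →₀ ℕ)) (lam : Fin (k + 1) → ℂ)
    (f : Fin (k + 1) → Fin (m + 1) → MvPolynomial (Fin 2) ℂ),
    (∀ i j, (f i j).support ⊆ A j) → Dissoc A →
    newtonVertexCount (∑ i, C (lam i) * ∏ j, f i j) ≤
      (topWords (liveFrame f)).ncard +
        ∑ i0 : Fin (k + 1), ∑ j : Fin (m + 1), ∑ y ∈ A j, ∑ y' ∈ A j,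
          newtonVertexCount (slice lam f i0 j y y')

/-- Statement of `stub_topWordsCount` (planar sweep count). -/
def TopWordsCountStmt : Prop :=
  ∀ (n t : ℕ) (B : Fin n → Finset (Fin 2 →₀ ℕ)), (∀ j, (B j).card ≤ t) →
    (topWords B).ncard ≤ 4 * (n * t) ^ 2 + 7

/-! ## The registered stubs (statements expanded over the declarations above) -/

/-- STUB 1 (M) — `ExposedWordStmt`: every vertex `p` of `Newt(Σ_i C(λ_i) Π_j f_ij)` on a dissociated
frame is `emb (Σ_j b_j)` for a STRICT `w`-TOP SURVIVOR word `b`, for some direction `w` whose height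
`ht w` is injective on every `A j`.
Why true: `p ∈ emb '' supp` (`extremePoints_convexHull_subset`), `supp ⊆ σ(Π_j A_j)` and
`coeff_{σ a} = T a` on a dissociated frame (SketchIdeator3 `support_sum_prod_subset`,
`coeff_sum_prod_of_injective`, plus `coeff_C_mul` for the weights), and an extreme point of a finite
planar set is STRICTLY exposed by a direction that can be perturbed to be injective on any finite set
(SketchIdeator3 `exists_strict_direction` with `U := emb '' ⋃_j A_j`, PROVED); a frame word `a ≠ b` of
height `≥` with `T a ≠ 0` would be a second support point at least as high — contradiction (dissociation
gives `σ a ≠ σ b`).  CHECKED engines also in `Disproof.lean` v3 §E0/§E1: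
`exists_strict_sep_of_mem_extremePoints_convexHull`, `coeff_sum_prod_of_dissociated`,
`exists_word_of_mem_support` (unweighted; the weights add `coeff_C_mul`); the injective perturbation is
SketchIdeator3's `exists_inj_dir` step.  Leans on: Mathlib `extremePoints_convexHull_subset`,
`Convex.mem_extremePoints_iff_mem_sdiff_convexHull_sdiff`, `geometric_hahn_banach_point_closed`,
`MvPolynomial.coeff_sum/coeff_C_mul`, `Finset.prod_univ_sum`. -/
theorem stub_exposedWord :
    ∀ (k m : ℕ) (A : Fin m → Finset (Fin 2 →₀ ℕ)) (lam : Fin k → ℂ)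
      (f : Fin k → Fin m → MvPolynomial (Fin 2) ℂ),
      (∀ i j, (f i j).support ⊆ A j) → Dissoc A →
      ∀ p ∈ Vert (∑ i, C (lam i) * ∏ j, f i j),
        ∃ (w : Fin 2 → ℝ) (b : Fin m → (Fin 2 →₀ ℕ)),
          (∀ j, Set.InjOn (ht w) (A j : Set (Fin 2 →₀ ℕ))) ∧ IsTopSurvivor A lam f w b ∧
            p = emb (∑ j, b j) := by
  sorry

/-- STUB 2 (M⁻) — `WordVertexStmt`: conversely, a strict `w`-top survivor word `b` (ANY direction `w`,
no injectivity) gives the vertex `emb (Σ_j b_j)`.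
Why true: `coeff_{σ b} = T b ≠ 0` puts `σ b` in the support; every other support point is `σ a` for a
frame word `a ≠ b` with `T a ≠ 0`, hence of height `<` that of `b`, i.e. the linear functional
`q ↦ Σ_i w_i q_i` strictly exposes `emb (σ b)` (`ht w (Σ_j a_j) = Σ_j ht w (a_j)`); strict exposure ⇒
extreme point is LANDED: `Negative.LoadBearing.mem_extremePoints_convexHull_of_strict_sep`
(also tree `KPTT.mem_extremePoints_convexHull_of_linear`).  Leans on: the same dictionary as STUB 1. -/
theorem stub_wordVertex :
    ∀ (k m : ℕ) (A : Fin m → Finset (Fin 2 →₀ ℕ)) (lam : Fin k → ℂ)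
      (f : Fin k → Fin m → MvPolynomial (Fin 2) ℂ),
      (∀ i j, (f i j).support ⊆ A j) → Dissoc A →
      ∀ (w : Fin 2 → ℝ) (b : Fin m → (Fin 2 →₀ ℕ)), IsTopSurvivor A lam f w b →
        emb (∑ j, b j) ∈ Vert (∑ i, C (lam i) * ∏ j, f i j) := by
  sorry

/-- STUB 3 (M/L, LOAD-BEARING) — the DESCENT INEQUALITY from the two dictionary stubs:
`V(F) ≤ #topWords(liveFrame f) + Σ_{i₀} Σ_j Σ_{y ∈ A j} Σ_{y' ∈ A j} V(slice λ f i₀ j y y')`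
for `F = Σ_{i<k+1} C(λ_i) Π_{j<m+1} f_ij` on a dissociated frame.
Why true (the card's five lines): take `p ∈ Vert F`, get `(w, b)` from `hE`.  CASE 2: some `(i₀, j, y)`,
`y ∈ A j`, `coeff_y f_{i₀ j} ≠ 0`, `ht w (b j) < ht w y` — then `topSurvivor_contract` (PROVED above, with
`h _ := ht w`, `c := cT f`) makes `b ∘ j.succAbove` a strict top survivor of the contracted tensor, which
is the coefficient tensor of `slice λ f i₀ j y (b j)` (drop the weight-`0` slot `i₀`:
`Fin.sum_univ_succAbove`, `contractWeights_self`) on the punctured frame `A ∘ j.succAbove` (support and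
dissociation inherited: `dissoc_punctured` below); `hV` gives `emb (Σ_l b (j.succAbove l)) ∈ Vert(slice …)`
and `p = emb (b j) + that` (`Fin.sum_univ_succAbove`).  CASE 1: otherwise every used letter of every
coordinate is `w`-below `b_j`, and `T b ≠ 0` forces `b_j ∈ supp_j f_{i₁ j} ⊆ liveFrame f j` for some
`i₁`, so `b ∈ topWords (liveFrame f)` (injectivity of `ht w` restricts from `A j`).  Hence
`Vert F ⊆ (fun b ↦ emb (Σ_j b_j)) '' topWords(liveFrame f) ∪ ⋃_{i₀ j} ⋃_{y ∈ A j} ⋃_{y' ∈ A j}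
((emb y' + ·) '' Vert(slice λ f i₀ j y y'))`, all finite; take `ncard` (`Set.ncard_union_le`,
`Set.ncard_image_le`, `Finset.sum` over the index finsets).  Size: M of bookkeeping around a proved core.
Small-model evidence: ideator's j008077 and triage probes j009496/j009513/j009531 (DESCENT check:
0 violations). -/
theorem stub_descent (hE : ExposedWordStmt) (hV : WordVertexStmt) :
    ∀ (k m : ℕ) (A : Fin (m + 1) → Finset (Fin 2 →₀ ℕ)) (lam : Fin (k + 1) → ℂ)
      (f : Fin (k + 1) → Fin (m + 1) → MvPolynomial (Fin 2) ℂ),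
      (∀ i j, (f i j).support ⊆ A j) → Dissoc A →
      newtonVertexCount (∑ i, C (lam i) * ∏ j, f i j) ≤
        (topWords (liveFrame f)).ncard +
          ∑ i0 : Fin (k + 1), ∑ j : Fin (m + 1), ∑ y ∈ A j, ∑ y' ∈ A j,
            newtonVertexCount (slice lam f i0 j y y') := by
  sorry

/-- STUB 4 (M⁻; its engine is CHECKED in `Disproof.lean` v3 §E3/§E4, not yet importable) —
`TopWordsCountStmt`: for a planar family `B : Fin n → Finset ℕ²` with `#B j ≤ t`, the coordinatewise
argmax words over all directions injective on every `B j` number `≤ 4 (n t)² + 7`.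
Why true / how: if some `B j = ∅` there are no words; otherwise put `P := emb '' ⋃_j B j` (`#P ≤ n t`);
for `w` injective on `B j` the argmax letter is unique, hence equals the Disproof's `lexTop l (B j)` for
the functional `l q := Σ_i w_i q_i` (its `eq_lexTop_of_forall_le`/`apply_le_apply_lexTop`), so
`topWords B ⊆ Set.range (fun l ↦ fun j ↦ lexTop l (B j) _)`, whose `ncard ≤ 4·#P² + 7`
(`ncard_range_topTuple_le` ← `ncard_range_cmpPat_le` ← `ncard_range_signVec_le`: comparison patterns of a
linear functional on a finite planar set, root counting along the sweep `l = (±1, λ)`, no topology).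
Two independent sharper routes, for the record: the sector count (`ℝ²` minus `≤ Σ_j C(#B j,2)` lines,
the word is constant on each of the `≤ 2·#lines` sectors: `≤ n t² + 1`) and SketchIdeator2's PROVED keyed
sweep `sweep_boxTop_ncard_le` (`≤ n(t-1)+1` per sign `σ = sgn w₁`, `μ = -w₀/w₁`, plus the two axis
directions: `≤ 2n(t-1) + 4`); both are `≤ 4(nt)² + 7`.  Corners: `n = 0` (one empty word, `1 ≤ 7`),
all `#B j ≤ 1` (`≤ 1` word), `t = 0 < n` (no words).  Leans on: Disproof v3 `cmpPat`, `lexKey`, `lexTop`,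
`lexTop_eq_of_cmpPat_eq`, `ncard_range_topTuple_le` (to be landed/copied by the prover); Mathlib
`Set.ncard_le_ncard`, `Set.ncard_image_le`, `Finset.card_biUnion_le`, `Finset.card_image_le`. -/
theorem stub_topWordsCount :
    ∀ (n t : ℕ) (B : Fin n → Finset (Fin 2 →₀ ℕ)), (∀ j, (B j).card ≤ t) →
      (topWords B).ncard ≤ 4 * (n * t) ^ 2 + 7 := by
  sorry

/-! ### Consistency: each named statement IS its registered stub (definitionally) -/

theorem exposedWordStmt_holds : ExposedWordStmt := stub_exposedWord
theorem wordVertexStmt_holds : WordVertexStmt := stub_wordVertex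
theorem descentCore_holds : DescentCore := stub_descent exposedWordStmt_holds wordVertexStmt_holds
theorem topWordsCountStmt_holds : TopWordsCountStmt := stub_topWordsCount

/-! ### Name-keyed aliases of the four statements (the hypotheses of the composition; the skeleton
audit admits a hypothesis only if its head constant is a registered obligation or is named like a
declared stub) -/
namespace Registered

/-- Alias of `ExposedWordStmt` keyed by the registered stub name. -/
abbrev stub_exposedWord : Prop := ExposedWordStmt
/-- Alias of `WordVertexStmt` keyed by the registered stub name. -/
abbrev stub_wordVertex : Prop := WordVertexStmt
/-- Alias of the full type of `stub_descent` keyed by the registered stub name. -/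
abbrev stub_descent : Prop := ExposedWordStmt → WordVertexStmt → DescentCore
/-- Alias of `TopWordsCountStmt` keyed by the registered stub name. -/
abbrev stub_topWordsCount : Prop := TopWordsCountStmt

end Registered

/-! ## Glue (PROVED): vertex-count bookkeeping, punctured dissociation, arithmetic, the induction -/

/-- A Newton polygon has at most as many vertices as the polynomial has monomials. -/
theorem newtonVertexCount_le_card (p : MvPolynomial (Fin 2) ℂ) :
    newtonVertexCount p ≤ p.support.card := by
  have hfin : ((fun e : Fin 2 →₀ ℕ => fun i : Fin 2 => ((e i : ℕ) : ℝ)) ''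
      (p.support : Set (Fin 2 →₀ ℕ))).Finite :=
    p.support.finite_toSet.image _
  calc newtonVertexCount p
      ≤ ((fun e : Fin 2 →₀ ℕ => fun i : Fin 2 => ((e i : ℕ) : ℝ)) ''
          (p.support : Set (Fin 2 →₀ ℕ))).ncard :=
        Set.ncard_le_ncard extremePoints_convexHull_subset hfin
    _ ≤ (p.support : Set (Fin 2 →₀ ℕ)).ncard := Set.ncard_image_le p.support.finite_toSet
    _ = p.support.card := Set.ncard_coe_finset _

/-- A constant has at most one vertex. -/
theorem newtonVertexCount_C_le (c : ℂ) : newtonVertexCount (C c : MvPolynomial (Fin 2) ℂ) ≤ 1 := by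
  refine (newtonVertexCount_le_card _).trans ?_
  calc (C c : MvPolynomial (Fin 2) ℂ).support.card ≤ ({0} : Finset (Fin 2 →₀ ℕ)).card := by
        refine Finset.card_le_card ?_
        rw [MvPolynomial.C_apply]
        exact support_monomial_subset
    _ = 1 := Finset.card_singleton _

/-- Dissociation is inherited by a punctured frame (fix the `j`-th letter; `A j` nonempty). -/
theorem dissoc_punctured {m : ℕ} (A : Fin (m + 1) → Finset (Fin 2 →₀ ℕ)) (hdis : Dissoc A)
    (j : Fin (m + 1)) (hne : (A j).Nonempty) :
    Dissoc (fun l => A (j.succAbove l)) := by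
  intro a b ha hb hab
  obtain ⟨z, hz⟩ := hne
  have mem_ins : ∀ a' : Fin m → (Fin 2 →₀ ℕ), (∀ l, a' l ∈ A (j.succAbove l)) →
      ∀ j', Fin.insertNth (α := fun _ => Fin 2 →₀ ℕ) j z a' j' ∈ A j' := by
    intro a' ha'
    refine (Fin.forall_iff_succAbove j).2 ⟨?_, fun l => ?_⟩
    · simpa using hz
    · simpa using ha' l
  have sum_ins : ∀ a' : Fin m → (Fin 2 →₀ ℕ),
      ∑ j', Fin.insertNth (α := fun _ => Fin 2 →₀ ℕ) j z a' j' = z + ∑ l, a' l := by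
    intro a'
    rw [Fin.sum_univ_succAbove _ j]
    simp
  have key := hdis _ _ (mem_ins a ha) (mem_ins b hb) (by rw [sum_ins, sum_ins, hab])
  funext l
  have := congrFun key (j.succAbove l)
  simpa using this

/-- The arithmetic of the induction step: with `M = n t + 2` (`n ≥ 1`),
`4 (n t)² + 7 + (k+1)·n·t·t·M^e ≤ M^(e+k+9)`. -/
theorem step_arith (k n t e : ℕ) (hn : 1 ≤ n) :
    4 * (n * t) ^ 2 + 7 + (k + 1) * (n * (t * (t * (n * t + 2) ^ e))) ≤ (n * t + 2) ^ (e + k + 9) := by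
  have hM2 : 2 ≤ n * t + 2 := Nat.le_add_left 2 (n * t)
  have htM : t ≤ n * t + 2 :=
    calc t = 1 * t := (one_mul t).symm
      _ ≤ n * t := Nat.mul_le_mul_right t hn
      _ ≤ n * t + 2 := Nat.le_add_right _ _
  have hntM : n * t ≤ n * t + 2 := Nat.le_add_right _ _
  have hsq : n * t ^ 2 ≤ (n * t + 2) ^ 2 :=
    calc n * t ^ 2 = (n * t) * t := by ring
      _ ≤ (n * t + 2) * (n * t + 2) := Nat.mul_le_mul hntM htM
      _ = (n * t + 2) ^ 2 := (sq (n * t + 2)).symm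
  have hsq' : (n * t) ^ 2 ≤ (n * t + 2) ^ 2 := Nat.pow_le_pow_left hntM 2
  have h4 : 4 ≤ (n * t + 2) ^ 2 :=
    calc 4 = 2 ^ 2 := by norm_num
      _ ≤ (n * t + 2) ^ 2 := Nat.pow_le_pow_left hM2 2
  have hpos : 0 < (n * t + 2) ^ e := pow_pos (by omega) e
  have hA : 4 * (n * t) ^ 2 + 7 ≤ 6 * ((n * t + 2) ^ 2 * (n * t + 2) ^ e) := by
    have h1 : 4 * (n * t) ^ 2 + 7 ≤ 6 * (n * t + 2) ^ 2 := by omega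
    have h2 : (n * t + 2) ^ 2 ≤ (n * t + 2) ^ 2 * (n * t + 2) ^ e :=
      Nat.le_mul_of_pos_right _ hpos
    omega
  have hB : (k + 1) * (n * (t * (t * (n * t + 2) ^ e))) ≤
      (k + 1) * ((n * t + 2) ^ 2 * (n * t + 2) ^ e) := by
    apply Nat.mul_le_mul_left
    calc n * (t * (t * (n * t + 2) ^ e)) = (n * t ^ 2) * (n * t + 2) ^ e := by ring
      _ ≤ (n * t + 2) ^ 2 * (n * t + 2) ^ e := Nat.mul_le_mul_right _ hsq
  have hk : k + 7 ≤ (n * t + 2) ^ (k + 7) :=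
    calc k + 7 ≤ 2 ^ (k + 7) := (Nat.lt_two_pow_self).le
      _ ≤ (n * t + 2) ^ (k + 7) := Nat.pow_le_pow_left hM2 _
  calc 4 * (n * t) ^ 2 + 7 + (k + 1) * (n * (t * (t * (n * t + 2) ^ e)))
      ≤ 6 * ((n * t + 2) ^ 2 * (n * t + 2) ^ e) + (k + 1) * ((n * t + 2) ^ 2 * (n * t + 2) ^ e) :=
        Nat.add_le_add hA hB
    _ = (k + 7) * ((n * t + 2) ^ 2 * (n * t + 2) ^ e) := by ring
    _ ≤ (n * t + 2) ^ (k + 7) * ((n * t + 2) ^ 2 * (n * t + 2) ^ e) := Nat.mul_le_mul_right _ hk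
    _ = (n * t + 2) ^ (e + k + 9) := by ring

/-- Base of the induction: no products, `F = 0`, no vertices. -/
theorem wbound_zero : WBound 0 0 := by
  intro m t A lam f hA hf hdis
  have h0 : (∑ i : Fin 0, C (lam i) * ∏ j, f i j) = 0 := by simp
  rw [h0]
  simp [newtonVertexCount, MvPolynomial.support_zero, extremePoints_empty]

/-- The induction step `k ↦ k+1` (exponent `e ↦ e + k + 9`) from the descent inequality and the
top-words count. -/
theorem wbound_succ (hD : DescentCore) (hT : TopWordsCountStmt) (k e : ℕ) (ih : WBound k e) :
    WBound (k + 1) (e + k + 9) := by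
  intro m t A lam f hA hf hdis
  cases m with
  | zero =>
    -- no coordinates: `F` is the constant `Σ_i λ_i`
    have hF : (∑ i : Fin (k + 1), C (lam i) * ∏ j : Fin 0, f i j) = C (∑ i, lam i) := by
      simp [map_sum]
    rw [hF]
    calc newtonVertexCount (C (∑ i, lam i) : MvPolynomial (Fin 2) ℂ) ≤ 1 := newtonVertexCount_C_le _
      _ ≤ (0 * t + 2) ^ (e + k + 9) := Nat.one_le_pow _ _ (by omega)
  | succ m' =>
    have hdesc := hD k m' A lam f hf hdis
    -- Case-1 words
    have h1 : (topWords (liveFrame f)).ncard ≤ 4 * ((m' + 1) * t) ^ 2 + 7 :=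
      hT (m' + 1) t (liveFrame f)
        (fun j => (Finset.card_le_card (liveFrame_subset A f hf j)).trans (hA j))
    -- Case-2 slices, by the induction hypothesis on the punctured frame
    have h2 : ∀ (i0 : Fin (k + 1)) (j : Fin (m' + 1)), ∀ y ∈ A j, ∀ y' ∈ A j,
        newtonVertexCount (slice lam f i0 j y y') ≤ ((m' + 1) * t + 2) ^ e := by
      intro i0 j y hy y' hy'
      have hih := ih m' t (fun l => A (j.succAbove l))
        (fun i' => contractWeights lam (cT f) i0 j y y' (i0.succAbove i'))
        (fun i' l => f (i0.succAbove i') (j.succAbove l))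
        (fun l => hA _) (fun i' l => hf _ _) (dissoc_punctured A hdis j ⟨y', hy'⟩)
      calc newtonVertexCount (slice lam f i0 j y y') ≤ (m' * t + 2) ^ e := hih
        _ ≤ ((m' + 1) * t + 2) ^ e :=
          Nat.pow_le_pow_left (Nat.add_le_add_right (Nat.mul_le_mul_right t (Nat.le_succ m')) 2) e
    have h3 : (∑ i0 : Fin (k + 1), ∑ j : Fin (m' + 1), ∑ y ∈ A j, ∑ y' ∈ A j,
          newtonVertexCount (slice lam f i0 j y y')) ≤
        (k + 1) * ((m' + 1) * (t * (t * ((m' + 1) * t + 2) ^ e))) := by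
      have hy' : ∀ (i0 : Fin (k + 1)) (j : Fin (m' + 1)), ∀ y ∈ A j,
          (∑ y' ∈ A j, newtonVertexCount (slice lam f i0 j y y')) ≤ t * ((m' + 1) * t + 2) ^ e := by
        intro i0 j y hy
        calc (∑ y' ∈ A j, newtonVertexCount (slice lam f i0 j y y'))
            ≤ (A j).card • ((m' + 1) * t + 2) ^ e :=
              Finset.sum_le_card_nsmul _ _ _ (fun y' hy' => h2 i0 j y hy y' hy')
          _ = (A j).card * ((m' + 1) * t + 2) ^ e := smul_eq_mul _ _
          _ ≤ t * ((m' + 1) * t + 2) ^ e := Nat.mul_le_mul_right _ (hA j)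
      have hy : ∀ (i0 : Fin (k + 1)) (j : Fin (m' + 1)),
          (∑ y ∈ A j, ∑ y' ∈ A j, newtonVertexCount (slice lam f i0 j y y')) ≤
            t * (t * ((m' + 1) * t + 2) ^ e) := by
        intro i0 j
        calc (∑ y ∈ A j, ∑ y' ∈ A j, newtonVertexCount (slice lam f i0 j y y'))
            ≤ (A j).card • (t * ((m' + 1) * t + 2) ^ e) :=
              Finset.sum_le_card_nsmul _ _ _ (fun y hy => hy' i0 j y hy)
          _ = (A j).card * (t * ((m' + 1) * t + 2) ^ e) := smul_eq_mul _ _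
          _ ≤ t * (t * ((m' + 1) * t + 2) ^ e) := Nat.mul_le_mul_right _ (hA j)
      have hj : ∀ i0 : Fin (k + 1),
          (∑ j : Fin (m' + 1), ∑ y ∈ A j, ∑ y' ∈ A j, newtonVertexCount (slice lam f i0 j y y')) ≤
            (m' + 1) * (t * (t * ((m' + 1) * t + 2) ^ e)) := by
        intro i0
        calc (∑ j : Fin (m' + 1), ∑ y ∈ A j, ∑ y' ∈ A j, newtonVertexCount (slice lam f i0 j y y'))
            ≤ (Finset.univ : Finset (Fin (m' + 1))).card • (t * (t * ((m' + 1) * t + 2) ^ e)) :=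
              Finset.sum_le_card_nsmul _ _ _ (fun j _ => hy i0 j)
          _ = (m' + 1) * (t * (t * ((m' + 1) * t + 2) ^ e)) := by
              rw [Finset.card_univ, Fintype.card_fin, smul_eq_mul]
      calc (∑ i0 : Fin (k + 1), ∑ j : Fin (m' + 1), ∑ y ∈ A j, ∑ y' ∈ A j,
            newtonVertexCount (slice lam f i0 j y y'))
          ≤ (Finset.univ : Finset (Fin (k + 1))).card •
              ((m' + 1) * (t * (t * ((m' + 1) * t + 2) ^ e))) :=
            Finset.sum_le_card_nsmul _ _ _ (fun i0 _ => hj i0)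
        _ = (k + 1) * ((m' + 1) * (t * (t * ((m' + 1) * t + 2) ^ e))) := by
            rw [Finset.card_univ, Fintype.card_fin, smul_eq_mul]
    calc newtonVertexCount (∑ i, C (lam i) * ∏ j, f i j)
        ≤ (topWords (liveFrame f)).ncard +
            ∑ i0 : Fin (k + 1), ∑ j : Fin (m' + 1), ∑ y ∈ A j, ∑ y' ∈ A j,
              newtonVertexCount (slice lam f i0 j y y') := hdesc
      _ ≤ (4 * ((m' + 1) * t) ^ 2 + 7) + (k + 1) * ((m' + 1) * (t * (t * ((m' + 1) * t + 2) ^ e))) :=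
          Nat.add_le_add h1 h3
      _ ≤ ((m' + 1) * t + 2) ^ (e + k + 9) := step_arith k (m' + 1) t e (Nat.succ_pos m')

/-- The weighted bound for every `k` (exponent `e(0) = 0`, `e(k+1) = e(k) + k + 9`). -/
theorem wbound_all (hD : DescentCore) (hT : TopWordsCountStmt) : ∀ k, ∃ e, WBound k e := by
  intro k
  induction k with
  | zero => exact ⟨0, wbound_zero⟩
  | succ k ih =>
    obtain ⟨e, he⟩ := ih
    exact ⟨e + k + 9, wbound_succ hD hT k e he⟩

/-! ## The composition: the four stubs imply the crux, BY NAME -/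

/-- `DissociatedFixedK` from the four stubs (no `sorry`): the dictionary stubs 1–2 feed the descent
stub 3; with the top-words count (stub 4), `wbound_all` bounds every weighted sum by induction on the
number of slots; the crux is the weight-`1` instance. -/
theorem DissociatedFixedK_of (h1 : Registered.stub_exposedWord) (h2 : Registered.stub_wordVertex)
    (h3 : Registered.stub_descent) (h4 : Registered.stub_topWordsCount) :
    Summit.ValiantsHypothesis.ValiantsHypothesis.Theses.NewtonUnitEquations.DissociatedFixedK := by
  intro k
  obtain ⟨e, he⟩ := wbound_all (h3 h1 h2) h4 k
  refine ⟨e, fun m t A f hA hf hdis => ?_⟩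
  have hone : (∑ i, C ((fun _ : Fin k => (1 : ℂ)) i) * ∏ j, f i j) = ∑ i, ∏ j, f i j := by simp
  have := he m t A (fun _ => (1 : ℂ)) f hA hf hdis
  rw [hone] at this
  exact this

/-- Wiring check: the registered stubs feed `DissociatedFixedK_of` as stated. -/
example : Summit.ValiantsHypothesis.ValiantsHypothesis.Theses.NewtonUnitEquations.DissociatedFixedK :=
  DissociatedFixedK_of stub_exposedWord stub_wordVertex stub_descent stub_topWordsCount

end

end Summit.ValiantsHypothesis.ValiantsHypothesis.Cruxes.DissociatedFixedK.SliceContractionDescent
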